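import Mathlib
import Summits.ResolutionOfSingularities.ResolutionOfSingularities.Theorems.WeightedInvariantLocalWeightedDropTOT2StepBlowOne
import Summits.ResolutionOfSingularities.ResolutionOfSingularities.Theorems.WeightedInvariantLocalWeightedDropTOT2StepTranslated
import Summits.ResolutionOfSingularities.ResolutionOfSingularities.Theorems.WeightedInvariantLocalWeightedDropTOT2StepGraph

/-!
# TOT2-LINE (P3) B6 steps 5–6 RESTATED WITH THE DIMENSION-AWARE TRANSPORT BRICK B4

ENGINE crux `stmt-ResolutionOfSingularities-8899` (`LocalWeightedDrop`), skeleton v35, registered stub `stub_conflictBudget` (P3).  [OURS · L1 W4.3 ·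
res-L1-w43-stub-2 g6; def-free; nothing here is a statement of any manuscript; AI-produced, gate-checked, weaker than expert review.]
The landed step theorems (`…TOT2StepTranslated`, `…TOT2StepGraph`) take the downward transport brick B4 in its split-v1 shape
`P′ ∈ topPrimes d A′ → X e ∉ P′ → comap Φ P′ ∈ topPrimes d A`; the brick LANDED (res-L1-w43-lead-1, `…TOT2TopPrimesChartComap`) with one more
antecedent `ringKrullDim (R₃ ⧸ P′) = 1`.  Since the proofs only ever use B4 above one-dimensional primes, the same proofs go through with the
dimension-aware shape; this file records these variants (suffix `D`), which are the ones the glue `conflictBudget_laws` instantiates.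
* `conflictBudgetD_translated_leD/ltD`, `conflictBudgetD_graph_leD`.
-/

set_option linter.dupNamespace false -- mandated namespace of this single-conjunct summit

noncomputable section

namespace Summit.ResolutionOfSingularities.ResolutionOfSingularities.Theorems

namespace TOT2Branch

open MvPowerSeries IsLocalRing PolyDescent MonicDescent WildMonic Literature.AlgebraicGeometry.Resolution

variable {k : Type} [Field k]

section Step

variable {d : ℕ} {A A' : Fin d → MvPowerSeries (Fin 2) k} {N N' : Finset (Fin 2)}
  (Φ : MvPowerSeries (Fin 3) k →ₐ[k] MvPowerSeries (Fin 3) k)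

/-- **B6 STEP TRANSLATED POINT, WITH SLACK.**  Under the context for `(A, N)` and the bricks B3 / B4 / D3 / injectivity for an abstract chart `Φ`
with `Φ u₁ = u₁`, `Φ u₂ = u₁(u₂ + c)` (`c ≠ 0`), `Φ (toThree g) = toThree (g(u₁, u₁(u₂ + c)))`, and the line-prime hypothesis `hline` for the
successor label `A′` with `N′ = {0}`: `M′ ≤ M`, and `M′ < M` as soon as `β = 1` and some one-dimensional non-line top-locus prime of `A` has
`v(u₁) = 1`. -/
theorem conflictBudgetD_translated_leD (p : ℕ) [Fact p.Prime] [CharP k p] [IsAlgClosed k] {c : k} (hc0 : c ≠ 0)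
    (hΦX0 : Φ (X 0) = X 0) (hΦX1 : Φ (X 1) = X 0 * (X 1 + C c))
    (hΦ₂ : ∀ g : MvPowerSeries (Fin 2) k,
      Φ (toThree g) = toThree (subst (![X 0, X 0 * (X 1 + C c)] : Fin 2 → MvPowerSeries (Fin 2) k) g))
    (hB3 : ∀ (P' : Ideal (MvPowerSeries (Fin 3) k)) [P'.IsPrime], ringKrullDim (MvPowerSeries (Fin 3) k ⧸ P') = 1 →
      (X 0 : MvPowerSeries (Fin 3) k) ∉ P' →
      ringKrullDim (MvPowerSeries (Fin 3) k ⧸ P'.comap Φ) = 1 ∧ ∀ f, branchVal (P'.comap Φ) f = branchVal P' (Φ f))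
    (hB4 : ∀ (P' : Ideal (MvPowerSeries (Fin 3) k)), P' ∈ topPrimes d A' → ringKrullDim (MvPowerSeries (Fin 3) k ⧸ P') = 1 → (X 0 : MvPowerSeries (Fin 3) k) ∉ P' →
      P'.comap Φ ∈ topPrimes d A)
    (hD3 : ∀ (P Q : Ideal (MvPowerSeries (Fin 3) k)), P ∈ topPrimes d A → Q ∈ topPrimes d A → P ≠ Q →
      ringKrullDim (MvPowerSeries (Fin 3) k ⧸ P) = 1 → ringKrullDim (MvPowerSeries (Fin 3) k ⧸ Q) = 1 → pairVal P Q < ⊤)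
    (hinj : ∀ (P' Q' : Ideal (MvPowerSeries (Fin 3) k)), P'.IsPrime → Q'.IsPrime → ringKrullDim (MvPowerSeries (Fin 3) k ⧸ P') = 1 →
      ringKrullDim (MvPowerSeries (Fin 3) k ⧸ Q') = 1 → (X 0 : MvPowerSeries (Fin 3) k) ∉ P' → (X 0 : MvPowerSeries (Fin 3) k) ∉ Q' →
      P'.comap Φ = Q'.comap Φ → P' = Q')
    (hline : IsPermissibleTwoT d A' → ∃ L' ∈ topPrimes d A', (X 1 : MvPowerSeries (Fin 3) k) ∈ L' ∧
      (X 0 : MvPowerSeries (Fin 3) k) ∉ L' ∧ ringKrullDim (MvPowerSeries (Fin 3) k ⧸ L') = 1)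
    (hctx : ∃ (b : MvPowerSeries (Fin (2 + 1)) k) (δ : TameFourTupleDrop.Decoration k 2) (Θ : Fin (2 + 1) → MvPowerSeries (Fin (2 + 1)) k),
      TameFourTupleDrop.Admissible b δ ∧ 2 ≤ δ.o ∧ δ.c = d ∧ δ.PresBy d A N Θ)
    (hN' : N' = {0}) :
    conflictBudgetD d A' N' ≤ conflictBudgetD d A N ∧
      ∀ P₀ ∈ topPrimesDNL d A, 1 ≤ betaTwo d A N → branchVal P₀ (X 0) = 1 →
        conflictBudgetD d A' N' < conflictBudgetD d A N := by
  classical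
  have hd2 : 2 ≤ d := NCBranchPrimes.two_le_of_presContext hctx
  have hsq : Squarefree (NCPoly.monicGerm d A) := NCBranchPrimes.squarefree_monicGerm_of_presContext hctx
  -- `Φ` on the test functions
  have hΦC : Φ (C c) = C c := Φ.commutes c
  have hΦℓ : Φ (X 1 - X 0 * C c) = X 0 * X 1 := by rw [map_sub, map_mul, hΦX0, hΦX1, hΦC]; ring
  have hunit : IsUnit (X 1 + C c : MvPowerSeries (Fin 3) k) := by
    rw [MvPowerSeries.isUnit_iff_constantCoeff]; simp [hc0]
  -- the index sets
  have hfinS : (topPrimesDNL d A).Finite := (topPrimesNL_finite p hctx).subset (topPrimesDNL_subset_topPrimesNL d A)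
  set ι : Ideal (MvPowerSeries (Fin 3) k) → Ideal (MvPowerSeries (Fin 3) k) := fun P' => P'.comap Φ with hιdef
  have hιmem' : ∀ P' : Ideal (MvPowerSeries (Fin 3) k), P' ∈ topPrimes d A' → ringKrullDim (MvPowerSeries (Fin 3) k ⧸ P') = 1 →
      (X 0 : MvPowerSeries (Fin 3) k) ∉ P' → ι P' ∈ topPrimesDNL d A := by
    intro P' hP'top hdim' hX0'
    haveI := hP'top.1
    obtain ⟨hdim, -⟩ := hB3 P' hdim' hX0'
    refine ⟨⟨hB4 P' hP'top hdim' hX0', hdim⟩, ?_, ?_⟩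
    · rw [hιdef, Ideal.mem_comap]; show Φ (X 0) ∉ P'; rw [hΦX0]; exact hX0'
    · rw [hιdef, Ideal.mem_comap]; show Φ (X 1) ∉ P'; rw [hΦX1]
      exact fun h => (hP'top.1.mem_or_mem h).elim hX0' fun h1 => hP'top.1.ne_top (Ideal.eq_top_of_isUnit_mem _ h1 hunit)
  have hιmem : ∀ P' ∈ topPrimesDNL d A', ι P' ∈ topPrimesDNL d A := fun P' hP' => hιmem' P' hP'.1.1 hP'.1.2 hP'.2.1
  have hinjOn : Set.InjOn ι (topPrimesDNL d A') := by
    intro P' hP' Q' hQ' h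
    exact hinj P' Q' hP'.1.1.1 hQ'.1.1.1 hP'.1.2 hQ'.1.2 hP'.2.1 hQ'.2.1 h
  have hfinS' : (topPrimesDNL d A').Finite :=
    Set.Finite.of_finite_image (hfinS.subset (fun P hP => by obtain ⟨P', hP', rfl⟩ := hP; exact hιmem P' hP')) hinjOn
  set S := hfinS.toFinset with hSdef
  set S' := hfinS'.toFinset with hS'def
  have hmemS : ∀ {P}, P ∈ S ↔ P ∈ topPrimesDNL d A := fun {P} => Set.Finite.mem_toFinset _
  have hmemS' : ∀ {P'}, P' ∈ S' ↔ P' ∈ topPrimesDNL d A' := fun {P'} => Set.Finite.mem_toFinset _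
  -- the letter bit upstairs
  have hβ'1 : IsPermissibleTwoT d A' → betaTwo d A' N' = 1 := fun h => betaTwo_eq_one_iff.mpr (Or.inr h)
  have hβ'0 : ¬ IsPermissibleTwoT d A' → betaTwo d A' N' = 0 := fun h => by
    refine betaTwo_eq_zero_iff.mpr ?_
    rw [hN', Finset.mem_singleton]
    exact fun h' => h'.elim (by decide) h
  -- per-branch values: `a′ = a`, `a′ + b′ = v_P(u₂ − c u₁)`
  have hvals : ∀ P' ∈ topPrimesDNL d A',
      branchVal P' (X 0) ≠ ⊤ ∧ branchVal P' (X 1) ≠ ⊤ ∧ 1 ≤ branchVal P' (X 0) ∧ 1 ≤ branchVal P' (X 1) ∧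
      branchVal P' (X 0) = branchVal (ι P') (X 0) ∧
      branchVal P' (X 0) + branchVal P' (X 1) = branchVal (ι P') (X 1 - X 0 * C c) := by
    intro P' hP'
    obtain ⟨⟨hP'top, hdim'⟩, hX0', hX1'⟩ := hP'
    haveI := hP'top.1
    obtain ⟨-, hval⟩ := hB3 P' hdim' hX0'
    refine ⟨(branchVal_eq_top_iff_of_dim hdim' _).not.mpr hX0', (branchVal_eq_top_iff_of_dim hdim' _).not.mpr hX1',
      one_le_branchVal_X_of_dim hdim' 0, one_le_branchVal_X_of_dim hdim' 1, ?_, ?_⟩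
    · rw [hιdef]; show branchVal P' (X 0) = branchVal (P'.comap Φ) (X 0); rw [hval, hΦX0]
    · rw [hιdef]; show _ = branchVal (P'.comap Φ) (X 1 - X 0 * C c); rw [hval, hΦℓ, branchVal_mul_of_dim hdim']
  -- the slack
  set s : Ideal (MvPowerSeries (Fin 3) k) → ℕ := fun P' => if IsPermissibleTwoT d A' then 1 else betaTwo d A N * kappa (ι P')
    with hsdef
  -- charges
  have hc : ∀ P' ∈ S', charge d A' N' P' + s P' ≤ charge d A N (ι P') +
      2 * ∑ Q ∈ S.filter (fun Q => Q ∉ S'.image ι), ((pairVal (ι P') Q).toNat + (pairVal Q (ι P')).toNat) := by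
    intro P' hP'
    have hP'm := hmemS'.mp hP'
    obtain ⟨ha', hb', h1a, h1b, haa, hab⟩ := hvals P' hP'm
    have haa' : (branchVal P' (X 0)).toNat = (branchVal (ι P') (X 0)).toNat := by rw [haa]
    have h1a' := one_le_toNat h1a ha'
    have h1b' := one_le_toNat h1b hb'
    by_cases hperm : IsPermissibleTwoT d A'
    · -- births, paid by the dying line prime
      obtain ⟨L', hL'top, hX1L, hX0L, hdimL⟩ := hline hperm
      haveI := hL'top.1
      have hLmem : ι L' ∈ topPrimesDNL d A := hιmem' L' hL'top hdimL hX0L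
      haveI : (ι L').IsPrime := hLmem.1.1.1
      haveI : (ι P').IsPrime := (hιmem P' hP'm).1.1.1
      have hLdying : ι L' ∈ S.filter (fun Q => Q ∉ S'.image ι) := by
        refine mem_filter_not_mem_image.mpr ⟨hmemS.mpr hLmem, fun Q' hQ' hQ => ?_⟩
        have hQ'm := hmemS'.mp hQ'
        have hQL : Q' = L' := hinj Q' L' hQ'm.1.1.1 hL'top.1 hQ'm.1.2 hdimL hQ'm.2.1 hX0L hQ
        exact hQ'm.2.2 (by rw [hQL]; exact hX1L)
      have hne : ι P' ≠ ι L' := fun h => by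
        have hPL : P' = L' := hinj P' L' hP'm.1.1.1 hL'top.1 hP'm.1.2 hdimL hP'm.2.1 hX0L h
        exact hP'm.2.2 (by rw [hPL]; exact hX1L)
      have hℓL : (X 1 - X 0 * C c : MvPowerSeries (Fin 3) k) ∈ ι L' := by
        rw [hιdef, Ideal.mem_comap]; show Φ (X 1 - X 0 * C c) ∈ L'
        rw [hΦℓ]; exact Ideal.mul_mem_left _ _ hX1L
      -- `pair(P, P_ℓ) ≥ v_P(u₂ − c u₁)` by D7
      have hpair : branchVal (ι P') (X 1 - X 0 * C c) ≤ pairVal (ι P') (ι L') := by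
        rw [pairVal]
        refine le_iInf fun g => ?_
        obtain ⟨g, hgL, hgP⟩ := g
        have hmem : (X 1 - X 0 * toThree (C c : MvPowerSeries (Fin 2) k) : MvPowerSeries (Fin 3) k) ∈ ι L' := by
          rw [toThree_C]; exact hℓL
        have hnoY : ∀ e : Fin 2 →₀ ℕ, e 1 ≠ 0 → coeff e (C c : MvPowerSeries (Fin 2) k) = 0 := fun e he => by
          rw [coeff_C, if_neg]; rintro rfl; exact he rfl
        obtain ⟨q, hq⟩ := dvd_of_toThree_mem hLmem.2.1 hnoY hmem hgL
        show branchVal (ι P') (X 1 - X 0 * C c) ≤ branchVal (ι P') (toThree g)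
        have hg3 : toThree g = (X 1 - X 0 * C c) * toThree q := by
          rw [hq, map_mul, map_sub, map_mul, toThree_X, toThree_X, toThree_C]; rfl
        rw [hg3, branchVal_mul_of_dim (hιmem P' hP'm).1.2]
        exact le_self_add
      have hfinpair : pairVal (ι P') (ι L') < ⊤ :=
        hD3 _ _ (hιmem P' hP'm).1.1 hLmem.1.1 hne (hιmem P' hP'm).1.2 hLmem.1.2
      have hsingle : (pairVal (ι P') (ι L')).toNat + (pairVal (ι L') (ι P')).toNat ≤
          ∑ Q ∈ S.filter (fun Q => Q ∉ S'.image ι), ((pairVal (ι P') Q).toNat + (pairVal Q (ι P')).toNat) :=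
        Finset.single_le_sum (f := fun Q => (pairVal (ι P') Q).toNat + (pairVal Q (ι P')).toNat) (fun _ _ => Nat.zero_le _) hLdying
      have hab' : (branchVal P' (X 0)).toNat + (branchVal P' (X 1)).toNat ≤ (pairVal (ι P') (ι L')).toNat := by
        rw [← ENat.toNat_add ha' hb', hab]
        exact ENat.toNat_le_toNat hpair hfinpair.ne
      have hs1 : s P' = 1 := by simp [hsdef, hperm]
      rw [hs1, charge_eq d A' N', hβ'1 hperm, charge_eq d A N, branchMult, toNat_min_of_ne_top ha' hb']
      have hκ' := kappa_le_one P'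
      have h0 : 0 ≤ betaTwo d A N * (2 * ((branchVal (ι P') (X 1)).toNat - (branchMult (ι P')).toNat) + kappa (ι P')) := Nat.zero_le _
      omega
    · -- no births: the new charge is `2a′ = 2a`
      have hs0 : s P' = betaTwo d A N * kappa (ι P') := by simp [hsdef, hperm]
      rw [hs0, charge_eq d A' N', hβ'0 hperm, charge_eq d A N, zero_mul, add_zero]
      have hmono : betaTwo d A N * kappa (ι P') ≤
          betaTwo d A N * (2 * ((branchVal (ι P') (X 1)).toNat - (branchMult (ι P')).toNat) + kappa (ι P')) :=
        Nat.mul_le_mul_left _ (by omega)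
      omega
  -- surviving pairs do not increase
  have hq : ∀ P' ∈ S', ∀ Q' ∈ S', P' ≠ Q' → (pairVal P' Q').toNat ≤ (pairVal (ι P') (ι Q')).toNat := by
    intro P' hP' Q' hQ' hne
    have hP'm := hmemS'.mp hP'
    have hQ'm := hmemS'.mp hQ'
    haveI := hP'm.1.1.1
    haveI := hQ'm.1.1.1
    obtain ⟨-, hval⟩ := hB3 P' hP'm.1.2 hP'm.2.1
    have hle : pairVal P' Q' + branchVal P' (X 0) ≤ pairVal (ι P') (ι Q') :=
      pairVal_add_le_of_transport Φ.toRingHom (subst (![X 0, X 0 * (X 1 + C c)] : Fin 2 → MvPowerSeries (Fin 2) k)) hΦ₂ hP'm.1.2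
        rfl rfl (fun f => (hval f).symm ▸ rfl) (X 0) hQ'm.2.1 fun g hg0 => by
          obtain ⟨ĝ, hĝ⟩ := exists_chartTranslated_eq_mul c hg0
          exact ⟨ĝ, by rw [hĝ, map_mul, toThree_X]; rfl⟩
    have hιne : ι P' ≠ ι Q' := fun h => hne (hinjOn hP'm hQ'm h)
    have hfin : pairVal (ι P') (ι Q') < ⊤ :=
      hD3 _ _ (hιmem P' hP'm).1.1 (hιmem Q' hQ'm).1.1 hιne (hιmem P' hP'm).1.2 (hιmem Q' hQ'm).1.2
    exact ENat.toNat_le_toNat (le_trans le_self_add hle) hfin.ne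
  -- the comparison
  have hιS : ∀ P' ∈ S', ι P' ∈ S := fun P' hP' => hmemS.mpr (hιmem P' (hmemS'.mp hP'))
  have hinjS : Set.InjOn ι S' := fun P' hP' Q' hQ' h => hinjOn (hmemS'.mp hP') (hmemS'.mp hQ') h
  have hmain := budget_comparison S' S ι hιS hinjS (charge d A' N') s (charge d A N)
    (fun P' Q' => (pairVal P' Q').toNat) (fun P Q => (pairVal P Q).toNat) hq hc
  rw [conflictBudgetD_eq_sum hfinS' N', conflictBudgetD_eq_sum hfinS N, ← hSdef, ← hS'def]
  refine ⟨by omega, fun P₀ hP₀ hβ1 ha1 => ?_⟩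
  -- strictness: `P₀` dies (charge ≥ 2 freed) or survives (slack ≥ 1)
  by_cases hsurv : ∃ P' ∈ S', ι P' = P₀
  · obtain ⟨P', hP', hP'eq⟩ := hsurv
    have hs1 : 1 ≤ s P' := by
      by_cases hperm : IsPermissibleTwoT d A'
      · simp [hsdef, hperm]
      · rw [show s P' = betaTwo d A N * kappa (ι P') by simp [hsdef, hperm], hP'eq]
        have hP'm := hmemS'.mp hP'
        obtain ⟨-, -, -, h1b, haa, hab⟩ := hvals P' hP'm
        rw [hP'eq] at haa hab
        haveI := hP₀.1.1.1
        have h2 : 2 ≤ branchVal P₀ (X 1 - X 0 * C c) := by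
          rw [← hab, haa, ha1]
          calc (2 : ℕ∞) = 1 + 1 := one_add_one_eq_two.symm
            _ ≤ 1 + branchVal P' (X 1) := add_le_add_right h1b 1
        have hκ : kappa P₀ = 1 := kappa_eq_one_iff.mpr ⟨ha1, branchVal_X_one_eq_one_of_contact hP₀.1.2 hc0 ha1 h2⟩
        rw [hκ, mul_one]; exact hβ1
    have h1 : s P' ≤ ∑ P' ∈ S', s P' := Finset.single_le_sum (f := s) (fun _ _ => Nat.zero_le _) hP'
    omega
  · push Not at hsurv
    have hP₀S : P₀ ∈ S := hmemS.mpr hP₀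
    have hmem : P₀ ∈ S.filter (fun Q => Q ∉ S'.image ι) := mem_filter_not_mem_image.mpr ⟨hP₀S, hsurv⟩
    have h1 : charge d A N P₀ ≤ ∑ Q ∈ S.filter (fun Q => Q ∉ S'.image ι), charge d A N Q :=
      Finset.single_le_sum (fun _ _ => Nat.zero_le _) hmem
    have h2 : 2 ≤ charge d A N P₀ := two_le_charge p hd2 hsq (topPrimesDNL_subset_topPrimesNL d A hP₀) N
    omega

/-- **B6 STEP TRANSLATED POINT: the conf-law** — at a conflict state the budget DROPS (the transverse branch of D5 has `a = 1`, and `β = 1`). -/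
theorem conflictBudgetD_translated_ltD (p : ℕ) [Fact p.Prime] [CharP k p] [IsAlgClosed k] {c : k} (hc0 : c ≠ 0)
    (hΦX0 : Φ (X 0) = X 0) (hΦX1 : Φ (X 1) = X 0 * (X 1 + C c))
    (hΦ₂ : ∀ g : MvPowerSeries (Fin 2) k,
      Φ (toThree g) = toThree (subst (![X 0, X 0 * (X 1 + C c)] : Fin 2 → MvPowerSeries (Fin 2) k) g))
    (hB3 : ∀ (P' : Ideal (MvPowerSeries (Fin 3) k)) [P'.IsPrime], ringKrullDim (MvPowerSeries (Fin 3) k ⧸ P') = 1 →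
      (X 0 : MvPowerSeries (Fin 3) k) ∉ P' →
      ringKrullDim (MvPowerSeries (Fin 3) k ⧸ P'.comap Φ) = 1 ∧ ∀ f, branchVal (P'.comap Φ) f = branchVal P' (Φ f))
    (hB4 : ∀ (P' : Ideal (MvPowerSeries (Fin 3) k)), P' ∈ topPrimes d A' → ringKrullDim (MvPowerSeries (Fin 3) k ⧸ P') = 1 → (X 0 : MvPowerSeries (Fin 3) k) ∉ P' →
      P'.comap Φ ∈ topPrimes d A)
    (hD3 : ∀ (P Q : Ideal (MvPowerSeries (Fin 3) k)), P ∈ topPrimes d A → Q ∈ topPrimes d A → P ≠ Q →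
      ringKrullDim (MvPowerSeries (Fin 3) k ⧸ P) = 1 → ringKrullDim (MvPowerSeries (Fin 3) k ⧸ Q) = 1 → pairVal P Q < ⊤)
    (hinj : ∀ (P' Q' : Ideal (MvPowerSeries (Fin 3) k)), P'.IsPrime → Q'.IsPrime → ringKrullDim (MvPowerSeries (Fin 3) k ⧸ P') = 1 →
      ringKrullDim (MvPowerSeries (Fin 3) k ⧸ Q') = 1 → (X 0 : MvPowerSeries (Fin 3) k) ∉ P' → (X 0 : MvPowerSeries (Fin 3) k) ∉ Q' →
      P'.comap Φ = Q'.comap Φ → P' = Q')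
    (hline : IsPermissibleTwoT d A' → ∃ L' ∈ topPrimes d A', (X 1 : MvPowerSeries (Fin 3) k) ∈ L' ∧
      (X 0 : MvPowerSeries (Fin 3) k) ∉ L' ∧ ringKrullDim (MvPowerSeries (Fin 3) k ⧸ L') = 1)
    (hctx : ∃ (b : MvPowerSeries (Fin (2 + 1)) k) (δ : TameFourTupleDrop.Decoration k 2) (Θ : Fin (2 + 1) → MvPowerSeries (Fin (2 + 1)) k),
      TameFourTupleDrop.Admissible b δ ∧ 2 ≤ δ.o ∧ δ.c = d ∧ δ.PresBy d A N Θ)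
    (hin : InPoly d A) (hconf : NCPoly.Conflict d A N) (hN' : N' = {0}) :
    conflictBudgetD d A' N' < conflictBudgetD d A N := by
  have hd2 : 2 ≤ d := NCBranchPrimes.two_le_of_presContext hctx
  have hsq : Squarefree (NCPoly.monicGerm d A) := NCBranchPrimes.squarefree_monicGerm_of_presContext hctx
  obtain ⟨P₀, hP₀, ha1⟩ := exists_transverse_of_conflict p hctx hin hconf
  have hP₀D : P₀ ∈ topPrimesDNL d A := mem_topPrimesDNL_of_mem_topPrimesNL hP₀ (ringKrullDim_eq_one_of_mem_topPrimes p hd2 hsq hP₀.1)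
  have hβ1 : 1 ≤ betaTwo d A N := by rw [(betaTwo_eq_one_iff).mpr (Or.inl hconf.2.2.2)]
  exact (conflictBudgetD_translated_leD Φ p hc0 hΦX0 hΦX1 hΦ₂ hB3 hB4 hD3 hinj hline hctx hN').2 P₀ hP₀D hβ1 ha1

end Step

section StepGraph

variable {d : ℕ} {A A' : Fin d → MvPowerSeries (Fin 2) k} {N N' : Finset (Fin 2)}
  (Φ : MvPowerSeries (Fin 3) k →ₐ[k] MvPowerSeries (Fin 3) k)

/-- **B6 STEP GRAPH MOVE.**  Under the context for `(A, N)`, `InPoly d A`, `¬Perm2 A`, `u₂ ∉ N`, a graph datum `(h₀, ψ)`, the bricks B3 / B4 / D3 /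
injectivity for an abstract chart `Φ` with `Φ u₁ = u₁`, `Φ (u₂ − u₁h₀) = u₂`, `Φ (toThree g) = toThree (φ₂ g)`, and the no-line fact `hNL` for
`A`: for every successor label `A′` with `u₂ ∈ N′`, `M′ ≤ M`. -/
theorem conflictBudgetD_graph_leD (p : ℕ) [Fact p.Prime] [CharP k p] [IsAlgClosed k]
    {h₀ ψ : MvPowerSeries (Fin 2) k} (φ₂ : MvPowerSeries (Fin 2) k → MvPowerSeries (Fin 2) k)
    (hh₀ : ∀ e : Fin 2 →₀ ℕ, e 1 ≠ 0 → coeff e h₀ = 0) (hψ : constantCoeff ψ = 0)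
    (hperm : IsPermissibleTwoT d (shift d (shearT h₀ A) ψ))
    (hin : InPoly d A) (h2 : ¬ IsPermissibleTwoT d A) (h1N : (1 : Fin 2) ∉ N)
    (hΦX0 : Φ (X 0) = X 0) (hΦℓ : Φ (X 1 - X 0 * toThree h₀) = X 1)
    (hΦ₂ : ∀ g : MvPowerSeries (Fin 2) k, Φ (toThree g) = toThree (φ₂ g))
    (hB3 : ∀ (P' : Ideal (MvPowerSeries (Fin 3) k)) [P'.IsPrime], ringKrullDim (MvPowerSeries (Fin 3) k ⧸ P') = 1 →
      (X 1 : MvPowerSeries (Fin 3) k) ∉ P' →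
      ringKrullDim (MvPowerSeries (Fin 3) k ⧸ P'.comap Φ) = 1 ∧ ∀ f, branchVal (P'.comap Φ) f = branchVal P' (Φ f))
    (hB4 : ∀ (P' : Ideal (MvPowerSeries (Fin 3) k)), P' ∈ topPrimes d A' → ringKrullDim (MvPowerSeries (Fin 3) k ⧸ P') = 1 → (X 1 : MvPowerSeries (Fin 3) k) ∉ P' →
      P'.comap Φ ∈ topPrimes d A)
    (hD3 : ∀ (P Q : Ideal (MvPowerSeries (Fin 3) k)), P ∈ topPrimes d A → Q ∈ topPrimes d A → P ≠ Q →
      ringKrullDim (MvPowerSeries (Fin 3) k ⧸ P) = 1 → ringKrullDim (MvPowerSeries (Fin 3) k ⧸ Q) = 1 → pairVal P Q < ⊤)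
    (hinj : ∀ (P' Q' : Ideal (MvPowerSeries (Fin 3) k)), P'.IsPrime → Q'.IsPrime → ringKrullDim (MvPowerSeries (Fin 3) k ⧸ P') = 1 →
      ringKrullDim (MvPowerSeries (Fin 3) k ⧸ Q') = 1 → (X 1 : MvPowerSeries (Fin 3) k) ∉ P' → (X 1 : MvPowerSeries (Fin 3) k) ∉ Q' →
      P'.comap Φ = Q'.comap Φ → P' = Q')
    (hNL : ∀ P ∈ topPrimes d A, ringKrullDim (MvPowerSeries (Fin 3) k ⧸ P) = 1 → (X 0 : MvPowerSeries (Fin 3) k) ∉ P →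
      (X 1 : MvPowerSeries (Fin 3) k) ∉ P)
    (hctx : ∃ (b : MvPowerSeries (Fin (2 + 1)) k) (δ : TameFourTupleDrop.Decoration k 2) (Θ : Fin (2 + 1) → MvPowerSeries (Fin (2 + 1)) k),
      TameFourTupleDrop.Admissible b δ ∧ 2 ≤ δ.o ∧ δ.c = d ∧ δ.PresBy d A N Θ)
    (hN' : (1 : Fin 2) ∈ N') :
    conflictBudgetD d A' N' ≤ conflictBudgetD d A N := by
  classical
  have hd2 : 2 ≤ d := NCBranchPrimes.two_le_of_presContext hctx
  have hsq : Squarefree (NCPoly.monicGerm d A) := NCBranchPrimes.squarefree_monicGerm_of_presContext hctx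
  -- the dying graph prime
  obtain ⟨PΓ, hPΓNL, hℓΓ⟩ := exists_graphPrimeNL (by omega) hin.1 hin.2.1 h2 hh₀ hψ hperm
  have hPΓD : PΓ ∈ topPrimesDNL d A :=
    mem_topPrimesDNL_of_mem_topPrimesNL hPΓNL (ringKrullDim_eq_one_of_mem_topPrimes p hd2 hsq hPΓNL.1)
  haveI : PΓ.IsPrime := hPΓNL.1.1
  -- the letter bits
  have hβ : betaTwo d A N = 0 := betaTwo_eq_zero_iff.mpr (not_or.mpr ⟨h1N, h2⟩)
  have hβ' : betaTwo d A' N' = 1 := betaTwo_eq_one_iff.mpr (Or.inl hN')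
  -- the index sets
  have hfinS : (topPrimesDNL d A).Finite := (topPrimesNL_finite p hctx).subset (topPrimesDNL_subset_topPrimesNL d A)
  set ι : Ideal (MvPowerSeries (Fin 3) k) → Ideal (MvPowerSeries (Fin 3) k) := fun P' => P'.comap Φ with hιdef
  have hιmem : ∀ P' ∈ topPrimesDNL d A', ι P' ∈ topPrimesDNL d A := by
    intro P' hP'
    obtain ⟨⟨hP'top, hdim'⟩, hX0', hX1'⟩ := hP'
    haveI := hP'top.1
    obtain ⟨hdim, -⟩ := hB3 P' hdim' hX1'
    have htop : ι P' ∈ topPrimes d A := hB4 P' hP'top hdim' hX1'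
    have hX0 : (X 0 : MvPowerSeries (Fin 3) k) ∉ ι P' := by
      rw [hιdef, Ideal.mem_comap]; show Φ (X 0) ∉ P'; rw [hΦX0]; exact hX0'
    exact ⟨⟨htop, hdim⟩, hX0, hNL _ htop hdim hX0⟩
  have hinjOn : Set.InjOn ι (topPrimesDNL d A') := by
    intro P' hP' Q' hQ' h
    exact hinj P' Q' hP'.1.1.1 hQ'.1.1.1 hP'.1.2 hQ'.1.2 hP'.2.2 hQ'.2.2 h
  have hfinS' : (topPrimesDNL d A').Finite :=
    Set.Finite.of_finite_image (hfinS.subset (fun P hP => by obtain ⟨P', hP', rfl⟩ := hP; exact hιmem P' hP')) hinjOn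
  set S := hfinS.toFinset with hSdef
  set S' := hfinS'.toFinset with hS'def
  have hmemS : ∀ {P}, P ∈ S ↔ P ∈ topPrimesDNL d A := fun {P} => Set.Finite.mem_toFinset _
  have hmemS' : ∀ {P'}, P' ∈ S' ↔ P' ∈ topPrimesDNL d A' := fun {P'} => Set.Finite.mem_toFinset _
  -- per-branch values: `a′ = a`, `b′ = v_P(u₂ − u₁h₀)`
  have hvals : ∀ P' ∈ topPrimesDNL d A',
      branchVal P' (X 0) ≠ ⊤ ∧ branchVal P' (X 1) ≠ ⊤ ∧ 1 ≤ branchVal P' (X 0) ∧ 1 ≤ branchVal P' (X 1) ∧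
      branchVal P' (X 0) = branchVal (ι P') (X 0) ∧ branchVal P' (X 1) = branchVal (ι P') (X 1 - X 0 * toThree h₀) := by
    intro P' hP'
    obtain ⟨⟨hP'top, hdim'⟩, hX0', hX1'⟩ := hP'
    haveI := hP'top.1
    obtain ⟨-, hval⟩ := hB3 P' hdim' hX1'
    refine ⟨(branchVal_eq_top_iff_of_dim hdim' _).not.mpr hX0', (branchVal_eq_top_iff_of_dim hdim' _).not.mpr hX1',
      one_le_branchVal_X_of_dim hdim' 0, one_le_branchVal_X_of_dim hdim' 1, ?_, ?_⟩
    · rw [hιdef]; show branchVal P' (X 0) = branchVal (P'.comap Φ) (X 0); rw [hval, hΦX0]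
    · rw [hιdef]; show _ = branchVal (P'.comap Φ) (X 1 - X 0 * toThree h₀); rw [hval, hΦℓ]
  -- the graph prime dies
  have hΓdying : PΓ ∈ S.filter (fun Q => Q ∉ S'.image ι) := by
    refine mem_filter_not_mem_image.mpr ⟨hmemS.mpr hPΓD, fun Q' hQ' hQ => ?_⟩
    obtain ⟨-, hb', -, -, -, hbb⟩ := hvals Q' (hmemS'.mp hQ')
    apply hb'
    rw [hbb, hQ, branchVal_eq_top_iff_of_dim hPΓD.1.2]
    exact hℓΓ
  -- charges: the births are paid by the pair term with the graph prime
  have hc : ∀ P' ∈ S', charge d A' N' P' + 1 ≤ charge d A N (ι P') +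
      2 * ∑ Q ∈ S.filter (fun Q => Q ∉ S'.image ι), ((pairVal (ι P') Q).toNat + (pairVal Q (ι P')).toNat) := by
    intro P' hP'
    have hP'm := hmemS'.mp hP'
    obtain ⟨ha', hb', h1a, h1b, haa, hbb⟩ := hvals P' hP'm
    haveI := hP'm.1.1.1
    haveI : (ι P').IsPrime := (hιmem P' hP'm).1.1.1
    have hne : ι P' ≠ PΓ := (mem_filter_not_mem_image.mp hΓdying).2 P' hP'
    have hpair : branchVal (ι P') (X 1 - X 0 * toThree h₀) ≤ pairVal (ι P') PΓ := by
      rw [pairVal]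
      refine le_iInf fun g => ?_
      obtain ⟨g, hgΓ, hgP⟩ := g
      obtain ⟨q, hq⟩ := dvd_of_toThree_mem hPΓNL.2.1 hh₀ hℓΓ hgΓ
      show branchVal (ι P') (X 1 - X 0 * toThree h₀) ≤ branchVal (ι P') (toThree g)
      have hg3 : toThree g = (X 1 - X 0 * toThree h₀) * toThree q := by
        rw [hq, map_mul, map_sub, map_mul, toThree_X, toThree_X]; rfl
      rw [hg3, branchVal_mul_of_dim (hιmem P' hP'm).1.2]
      exact le_self_add
    have hfinpair : pairVal (ι P') PΓ < ⊤ := hD3 _ _ (hιmem P' hP'm).1.1 hPΓD.1.1 hne (hιmem P' hP'm).1.2 hPΓD.1.2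
    have hsingle : (pairVal (ι P') PΓ).toNat + (pairVal PΓ (ι P')).toNat ≤
        ∑ Q ∈ S.filter (fun Q => Q ∉ S'.image ι), ((pairVal (ι P') Q).toNat + (pairVal Q (ι P')).toNat) :=
      Finset.single_le_sum (f := fun Q => (pairVal (ι P') Q).toNat + (pairVal Q (ι P')).toNat) (fun _ _ => Nat.zero_le _) hΓdying
    have hb'le : (branchVal P' (X 1)).toNat ≤ (pairVal (ι P') PΓ).toNat := by
      rw [hbb]; exact ENat.toNat_le_toNat hpair hfinpair.ne
    have haa' : (branchVal P' (X 0)).toNat = (branchVal (ι P') (X 0)).toNat := by rw [haa]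
    have h1a' := one_le_toNat h1a ha'
    have h1b' := one_le_toNat h1b hb'
    rw [charge_eq d A' N', hβ', charge_eq d A N, hβ, branchMult, toNat_min_of_ne_top ha' hb', zero_mul, add_zero]
    have hκ' := kappa_le_one P'
    omega
  -- surviving pairs do not increase (`u = 1`)
  have hq : ∀ P' ∈ S', ∀ Q' ∈ S', P' ≠ Q' → (pairVal P' Q').toNat ≤ (pairVal (ι P') (ι Q')).toNat := by
    intro P' hP' Q' hQ' hne
    have hP'm := hmemS'.mp hP'
    have hQ'm := hmemS'.mp hQ'
    haveI := hP'm.1.1.1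
    haveI := hQ'm.1.1.1
    obtain ⟨-, hval⟩ := hB3 P' hP'm.1.2 hP'm.2.2
    have hle : pairVal P' Q' + branchVal P' 1 ≤ pairVal (ι P') (ι Q') :=
      pairVal_add_le_of_transport Φ.toRingHom φ₂ hΦ₂ hP'm.1.2 rfl rfl (fun f => (hval f).symm ▸ rfl) 1
        (fun h => hQ'm.1.1.1.ne_top ((Ideal.eq_top_iff_one _).mpr h)) fun g _ => ⟨φ₂ g, by rw [one_mul]⟩
    have hιne : ι P' ≠ ι Q' := fun h => hne (hinjOn hP'm hQ'm h)
    have hfin : pairVal (ι P') (ι Q') < ⊤ :=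
      hD3 _ _ (hιmem P' hP'm).1.1 (hιmem Q' hQ'm).1.1 hιne (hιmem P' hP'm).1.2 (hιmem Q' hQ'm).1.2
    exact ENat.toNat_le_toNat (le_trans le_self_add hle) hfin.ne
  -- the comparison
  have hιS : ∀ P' ∈ S', ι P' ∈ S := fun P' hP' => hmemS.mpr (hιmem P' (hmemS'.mp hP'))
  have hinjS : Set.InjOn ι S' := fun P' hP' Q' hQ' h => hinjOn (hmemS'.mp hP') (hmemS'.mp hQ') h
  have hmain := budget_comparison S' S ι hιS hinjS (charge d A' N') (fun _ => 1) (charge d A N)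
    (fun P' Q' => (pairVal P' Q').toNat) (fun P Q => (pairVal P Q).toNat) hq hc
  rw [conflictBudgetD_eq_sum hfinS' N', conflictBudgetD_eq_sum hfinS N, ← hSdef, ← hS'def]
  omega

end StepGraph

end TOT2Branch

end Summit.ResolutionOfSingularities.ResolutionOfSingularities.Theorems

end
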